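import Summits.PneNP.PneNP.Theorems.ChebyshevTracialDesignGammaDirectionSecondMomentSlot
import Summits.PneNP.PneNP.Theorems.ChebyshevTracialDesignGammaDirectionFirstMomentBudget
import Summits.PneNP.PneNP.Theorems.ChebyshevTracialDesignGammaDirectionCriterion
import HarnessLib

/-!
# Cell pnp-psdrank, route `ChebyshevTracialDesign`: brick 130's γ-direction criterion with its three centred inputs DISCHARGED
# (crux `TracialDecayExp20`, stmt-PneNP-19878)

Brick 141 (prover g28; MEMO-31 §3(b)). Brick 130 (`…GammaDirectionCriterion.gammaProfile_newton_eval_zero_ge_of_centred`) says: on a window `B`,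
if for a centring `m(x)` with `B^m_1(x) = 0` the three profiles `A^m_·(x)`, `B^m_·(x)`, `law_·(x)` are relatively level-smooth with
`ε_A + ε_B ≤ 1`, `ε_C + ε_B ≤ 1`, then `N^{odd}_D[Φ](0) ≥ −2^{D+1}G(2n+3t)²·(law tail off B)` for every `|γ|,|λ|,|κ| ≤ 1`. This file plugs the
three slots now in the tree — (hA) ← `centredSecond_slot` (brick 141a, prover), (hBm) ← eng g26's `sum_abs_fwdDiff_centredFirst_le_of_budgets`
(brick 137 §3) fed with the same dominated budgets, (hC) ← eng's `sum_abs_fwdDiff_shellLaw_le_of_budget`, `hcentre` ← eng's `hcentre_condMean`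
(the conditional mean `m(x) = E_1[n_A | X = x]`) — with `ε_A := ¾`, `ε_B := ¼`, `ε_C := ¼`:

* §1 **`budgets_zero_one_at`**: at one point `x` (and `x−2`), the budgets of the family on `[n]` (Lq) and of the one-pinned family (brick 136)
  dominated by one `(Γ, q)` and the tail `e^{−(L−2D)²/(4N₀)}`, in the currency of eng's `…_of_budgets` theorems.
* §2 **`gammaProfile_newton_eval_zero_ge_discharged`**: for a perfect matching `M`, block `H` of type `(a,b,d)` (`a ≥ 2`), cut `2s+1` (`s = r+3`), orders
  `D`, Lq's margins once at `(N₀−2, ε+8)`, brick 139's `k = 1` leg (`Lx`, `E`, `Far`), the six `lqConstants_le`-shaped comparisons (`q ≤ ½`), a window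
  set `B ⊆ [2D+4, 2s+1] ∩ {|x − (2s+1)|H|/n| < ε}` of INTEGERS, the variance floor `cV·law_1(x) ≤ A^m_1(x)` for all `x ∈ B` and all real `m` (lit's
  `centredSq_law_ge_of_window_one`), the window floor `LB ≤ law_1(x)` on `B`, and the three SMALLNESS hypotheses `ε_A ≤ ¾` (brick 139's expression;
  eng's brick 140d), `ε_B(m) ≤ ¼` for `0 ≤ m ≤ a` and `ε_C ≤ ¼` (eng's brick 140b shapes, in `(Γ,q)`): the CONCLUSION OF BRICK 130 for every `0 ≤ ψ ≤ G`
  and every `|γ|,|λ|,|κ| ≤ 1`.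
WHAT THIS FILE DOES NOT DO: the numerics (140b/140d turn the three smallness hypotheses into `P ≥ P*`), (V)/LB themselves, the plug into brick 134 /
the exp form / the `M`-average, anything on `TracialDecayExp20` itself, psd rank of P_PM(K_n), or P vs NP.
[cite: Rothvoss2017, §2 (PDF p. 6)] [cite: RollinRoss2010, §4.1 Thm 4.2] [cite: Agarwal2000DifferenceEquations, Thm. 1.8.5 (1.8.6), Remark 1.8.1 (1.8.8)]
Stature: support/instrument (kernel lane, no defs, axioms standard; constants asymptotic only). Supports stmt-PneNP-19878.
-/

set_option linter.dupNamespace false -- `Summit.PneNP.PneNP.…`: summit = sub-problem (D-0017)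

noncomputable section

namespace Summit.PneNP.PneNP.Theorems.ChebyshevTracialDesignGammaDirectionCentredDischarge

open Finset Polynomial Literature.Barriers.PneNP Literature.Combinatorics.Optimization
open Literature.Combinatorics.Optimization.ShellStep
open Summit.PneNP.PneNP.Theorems.ChebyshevTracialDesignShellOperatorForm (shell_partner_nonempty)
open Summit.PneNP.PneNP.Theorems.ChebyshevTracialDesignGammaDirectionSecondMomentSlot (centredSecond_slot lqShape_dominate)
open Summit.PneNP.PneNP.Theorems.ChebyshevTracialDesignGammaDirectionLevelBudgets (levelBudget_pin1 lqMargins_mono)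
open Summit.PneNP.PneNP.Theorems.ChebyshevTracialDesignGammaDirectionFirstMomentTurnkey (window_pin1 hcentre_condMean condMean_mem_Icc)
open Summit.PneNP.PneNP.Theorems.ChebyshevTracialDesignGammaDirectionFirstMomentBudget (sum_abs_fwdDiff_centredFirst_le_of_budgets
  sum_abs_fwdDiff_shellLaw_le_of_budget)
open Summit.PneNP.PneNP.Theorems.ChebyshevTracialDesignLqConstantsScale (exp_far_mono)
open Summit.PneNP.PneNP.Theorems.ChebyshevTracialDesignGammaDirectionCriterion (gammaProfile_newton_eval_zero_ge_of_centred)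

variable {n : ℕ}

/-! ### §1 The budgets of the family on `[n]` and of the one-pinned family at one point, dominated -/

set_option maxHeartbeats 400000 in -- passes at the default 200 000; ×2 head-room (two Lq-type instantiations + domination in one context)
/-- **Budgets at one point, dominated** (Lq at `(N₀, 2s+1, x)`, brick 136 `levelBudget_pin1` at `(N₀−1, 2s₁+1, x₁ = x−2)`; margins once at `(N₀−2, ε+8)`;
`Γ(N_i) ≤ Γ`, `q(N_i) ≤ q` in `lqConstants_le`'s shape; tails by `e^{−(L−2D)²/(4N₀)}`). [cite: RollinRoss2010, §4.1 Thm 4.2] -/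
theorem budgets_zero_one_at (M : PMatch n) (H : Finset (Fin n)) {a b d N₀ N₁ N₂ s s₁ s₂ D x x₁ : ℕ}
    (hN01 : N₁ + 1 = N₀) (hN12 : N₂ + 1 = N₁) (hs₁ : s₁ + 1 = s) (hs₂ : s₂ + 1 = s₁) (hx₁ : x₁ + 2 = x) (ha2 : 2 ≤ a)
    (ha : (reps M.2.partner (vAA M.2.partner univ H)).card = a)
    (hb : (reps M.2.partner (vBH M.2.partner univ H ∪ vBN M.2.partner univ H)).card = b)
    (hd : (reps M.2.partner (vDD M.2.partner univ H)).card = d) (hN : a + b + d = N₀) (hn : n = 2 * N₀)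
    {β : ℝ} (hβ : 0 < β) (hβ1 : β ≤ 1 / 4) (hD1 : 1 ≤ D) (hDN : 16 * D + 16 ≤ N₂)
    (hbβ : β * N₀ + 2 * D + 1 ≤ b) (hdβ : β * N₀ + 2 * D + 1 ≤ d)
    (hs : β * N₂ + D ≤ s₂) (hs' : 8 * (s : ℝ) ≤ (4 + β) * ((N₀ : ℝ) - 2 * D)) (hDs : D ≤ s₂) (hsn : 2 * s + 2 * D + 2 ≤ n)
    {ε : ℝ} (hxε : |(x : ℝ) - (2 * (s : ℝ) + 1) * H.card / n| < ε) (hxD : 2 * D ≤ x₁)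
    {L : ℝ} (h2D : 2 * (D : ℝ) ≤ L) (hLN : 2 * L ≤ N₂)
    (h1 : L + D + (ε + 8 + 14 * D + 1) ≤ β ^ 2 * N₂)
    (h2 : L + D + (ε + 8 + 14 * D + 1) + 3 ≤ β * ((N₂ : ℝ) - 2 * D) / 8)
    (h3 : 2 * (L + D + 1) ≤ (β ^ 2 / 8) ^ 2 * (β * ((N₂ : ℝ) - 2 * D)))
    (h4 : 4 ≤ β * ((N₂ : ℝ) - 2 * D))
    (h5 : (D : ℝ) * (1 + 8 * (L + D + 1) / ((β ^ 2 / 8) ^ 4 * (β * ((N₂ : ℝ) - 2 * D)))) ≤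
      (β ^ 2 / 8) ^ 4 * (β * ((N₂ : ℝ) - 2 * D)))
    {Γ q : ℝ}
    (hΓ₀ : (1 + 4 * (Real.sqrt N₀ + 1) / 3 *
          (2 * Real.sqrt 192 * Real.sqrt (2 * (2 * (D : ℝ) + 1) * (1 + 8 * (L + D + 1) / ((β ^ 2 / 8) ^ 4 * (β * ((N₀ : ℝ) - 2 * D)))) /
            ((β ^ 2 / 8) ^ 4 * (β * ((N₀ : ℝ) - 2 * D)))))) ≤ Γ)
    (hΓ₁ : (1 + 4 * (Real.sqrt N₁ + 1) / 3 *
          (2 * Real.sqrt 192 * Real.sqrt (2 * (2 * (D : ℝ) + 1) * (1 + 8 * (L + D + 1) / ((β ^ 2 / 8) ^ 4 * (β * ((N₁ : ℝ) - 2 * D)))) /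
            ((β ^ 2 / 8) ^ 4 * (β * ((N₁ : ℝ) - 2 * D)))))) ≤ Γ)
    (hq₀ : (4 * ((1 + 8 * (L + D + 1) / ((β ^ 2 / 8) ^ 4 * (β * ((N₀ : ℝ) - 2 * D)))) *
          (8 * (L + D + 1) / ((β ^ 2 / 8) ^ 4 * (β * ((N₀ : ℝ) - 2 * D))) +
            2 * Real.sqrt 192 * Real.sqrt (2 * (2 * (D : ℝ) + 1) * (1 + 8 * (L + D + 1) / ((β ^ 2 / 8) ^ 4 * (β * ((N₀ : ℝ) - 2 * D)))) /
            ((β ^ 2 / 8) ^ 4 * (β * ((N₀ : ℝ) - 2 * D)))))) ^ 2 / (3 * β)) ≤ q)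
    (hq₁ : (4 * ((1 + 8 * (L + D + 1) / ((β ^ 2 / 8) ^ 4 * (β * ((N₁ : ℝ) - 2 * D)))) *
          (8 * (L + D + 1) / ((β ^ 2 / 8) ^ 4 * (β * ((N₁ : ℝ) - 2 * D))) +
            2 * Real.sqrt 192 * Real.sqrt (2 * (2 * (D : ℝ) + 1) * (1 + 8 * (L + D + 1) / ((β ^ 2 / 8) ^ 4 * (β * ((N₁ : ℝ) - 2 * D)))) /
            ((β ^ 2 / 8) ^ 4 * (β * ((N₁ : ℝ) - 2 * D)))))) ^ 2 / (3 * β)) ≤ q) :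
    (∀ k ∈ Ico 1 (D + 1), (((2 * k).choose k : ℕ) : ℝ) / (4 : ℝ) ^ k *
        |(fwdDiff (1 : ℕ))^[k] (fun j => shellLaw M.2.partner univ H (2 * s + 1) (2 * j + 1) x) 0| ≤
      Γ * q ^ k * shellLaw M.2.partner univ H (2 * s + 1) 1 x + (4 / 3 : ℝ) ^ k * Real.exp (-((L - 2 * D) ^ 2 / (4 * N₀)))) ∧
    (∀ k ∈ Ico 1 (D + 1), (((2 * k).choose k : ℕ) : ℝ) / (4 : ℝ) ^ k *
        |(fwdDiff (1 : ℕ))^[k] (fun j => ∑ v ∈ reps M.2.partner (vAA M.2.partner univ H),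
            shellLaw M.2.partner (univ \ {v, M.2.partner v}) H (2 * s₁ + 1) (2 * j + 1) x₁) 0| ≤
      Γ * q ^ k * (∑ v ∈ reps M.2.partner (vAA M.2.partner univ H), shellLaw M.2.partner (univ \ {v, M.2.partner v}) H (2 * s₁ + 1) 1 x₁) +
        (reps M.2.partner (vAA M.2.partner univ H)).card * ((4 / 3 : ℝ) ^ k * Real.exp (-((L - 2 * D) ^ 2 / (4 * N₀))))) := by
  classical
  have hπ := partner_partner M
  have hπ' := partner_ne M
  have hN0r : (N₀ : ℝ) = N₁ + 1 := by rw [← hN01]; push_cast; ring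
  have hN1r : (N₁ : ℝ) = N₂ + 1 := by rw [← hN12]; push_cast; ring
  have hsr : (s : ℝ) = s₁ + 1 := by rw [← hs₁]; push_cast; ring
  have hs1r : (s₁ : ℝ) = s₂ + 1 := by rw [← hs₂]; push_cast; ring
  have hD0 : (0 : ℝ) ≤ D := Nat.cast_nonneg _
  have hN2_16 : (16 : ℝ) ≤ N₂ := by exact_mod_cast (show 16 ≤ N₂ by omega)
  have hN2N1 : (N₂ : ℝ) ≤ N₁ := by rw [hN1r]; linarith only
  have hN1N0 : (N₁ : ℝ) ≤ N₀ := by rw [hN0r]; linarith only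
  have hN2N0 : (N₂ : ℝ) ≤ N₀ := hN2N1.trans hN1N0
  have hN1pos : (0 : ℝ) < N₁ := by linarith only [hN2_16, hN2N1]
  have hnr : (n : ℝ) = 2 * (N₀ : ℝ) := by rw [hn]; push_cast; ring
  have hsn' : 2 * (s : ℝ) + 2 * D + 2 ≤ n := by exact_mod_cast hsn
  have hs₂0 : (0 : ℝ) ≤ s₂ := Nat.cast_nonneg _
  have htypes := card_eq_two_mul_add_of_types hπ hπ' H
  rw [ha, hb] at htypes
  have hHcard : (H.card : ℝ) = 2 * a + b := by rw [htypes]; push_cast; ring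
  have habd : ((a : ℝ) + b + d) = N₀ := by exact_mod_cast hN
  have hb0 : (0 : ℝ) ≤ b := Nat.cast_nonneg _
  have hd0 : (0 : ℝ) ≤ d := Nat.cast_nonneg _
  -- margins at `N₁` and `N₀`
  obtain ⟨hLN₁, h1₁, h2₁, h3₁, h4₁, h5₁⟩ := lqMargins_mono (ε := ε + 8) hβ h2D hN2N1 hLN h1 h2 h3 h4 h5
  obtain ⟨hLN₀, h1₀, h2₀, h3₀, h4₀, h5₀⟩ := lqMargins_mono (ε := ε + 8) hβ h2D hN2N0 hLN h1 h2 h3 h4 h5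
  have h1₁' : L + D + (ε + 4 + 14 * D + 1) ≤ β ^ 2 * N₁ := by linarith only [h1₁]
  have h2₁' : L + D + (ε + 4 + 14 * D + 1) + 3 ≤ β * ((N₁ : ℝ) - 2 * D) / 8 := by linarith only [h2₁]
  have h1₀' : L + D + (ε + 14 * D + 1) ≤ β ^ 2 * N₀ := by linarith only [h1₀]
  have h2₀' : L + D + (ε + 14 * D + 1) + 3 ≤ β * ((N₀ : ℝ) - 2 * D) / 8 := by linarith only [h2₀]
  have hDN₁ : 16 * D + 16 ≤ N₁ := by omega
  have hDN₀ : 16 * D + 16 ≤ N₀ := by omega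
  have hβN1 : β * N₁ ≤ β * N₀ := mul_le_mul_of_nonneg_left hN1N0 hβ.le
  have hbβ₁ : β * N₁ + 2 * D + 1 ≤ b := by linarith only [hβN1, hbβ]
  have hdβ₁ : β * N₁ + 2 * D + 1 ≤ d := by linarith only [hβN1, hdβ]
  have hs₁' : β * N₁ + D ≤ s₁ := by
    have e : β * (N₁ : ℝ) = β * N₂ + β := by rw [hN1r]; ring
    rw [e, hs1r]; linarith only [hs, hβ1]
  have hs₀ : β * N₀ + D ≤ s := by
    have e : β * (N₀ : ℝ) = β * N₂ + 2 * β := by rw [hN0r, hN1r]; ring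
    rw [e, hsr, hs1r]; linarith only [hs, hβ1]
  have hs''₁ : 8 * (s₁ : ℝ) ≤ (4 + β) * ((N₁ : ℝ) - 2 * D) := by
    have e1 : 8 * (s₁ : ℝ) = 8 * s - 8 := by rw [hsr]; ring
    have e2 : (4 + β) * ((N₁ : ℝ) - 2 * D) = (4 + β) * ((N₀ : ℝ) - 2 * D) - (4 + β) := by rw [hN0r]; ring
    rw [e1, e2]; linarith only [hs', hβ1]
  have hne₀ : ∀ k, k ≤ D → (shellIn M.2.partner univ (2 * s + 1) (1 + 2 * k)).Nonempty := by
    intro k hk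
    rw [shellIn_univ]
    exact shell_partner_nonempty M ⟨s, by ring⟩ ⟨k, by ring⟩ (by omega) (by omega)
  -- the moved window
  have hx' : |(x : ℝ) - (2 * (s : ℝ) + 1) * (H.card : ℝ) / (2 * (N₀ : ℝ))| < ε := by rw [← hnr]; exact hxε
  have hw₁ := window_pin1 (P := (H.card : ℝ)) (by rw [hN0r]; linarith only [hN2_16, hN2N1]) (by exact_mod_cast (show 2 ≤ H.card by omega))
    (by rw [hHcard, ← habd]; linarith only [hb0, hd0])
    (by rw [hsr]; linarith only [hs1r, hs₂0]) (by rw [← hnr]; linarith only [hsn', hD0]) hx'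
  have ex₁ : (x : ℝ) - 2 = x₁ := by rw [← hx₁]; push_cast; ring
  have es₁ : 2 * (s : ℝ) - 1 = 2 * s₁ + 1 := by rw [hsr]; ring
  have eN₁ : (N₀ : ℝ) - 1 = N₁ := by rw [hN0r]; ring
  rw [ex₁, es₁, eN₁] at hw₁
  have hxε₁ : |(x₁ : ℝ) - (2 * (s₁ : ℝ) + 1) * ((H.card - 2 : ℕ) : ℝ) / ((n - 2 : ℕ) : ℝ)| < ε + 4 := by
    have e : ((H.card - 2 : ℕ) : ℝ) / ((n - 2 : ℕ) : ℝ) = ((H.card : ℝ) - 2) / (2 * (N₁ : ℝ)) := by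
      rw [Nat.cast_sub (by omega : 2 ≤ H.card), Nat.cast_sub (by omega : 2 ≤ n), hnr, hN0r]; push_cast; ring
    rw [mul_div_assoc, e, ← mul_div_assoc]; exact hw₁
  -- the two raw budgets
  have hR₀ := abs_fwdDiff_iter_shellLaw_le_of_hyps hπ hπ' H ha hb hd hN hn hβ hβ1 hDN₀ hbβ hdβ hs₀ hs' hne₀ hxε (by omega) h2D hLN₀
    h1₀' h2₀' h3₀ h4₀ h5₀
  have ha₁ : (reps M.2.partner (vAA M.2.partner univ H)).card = (a - 1) + 1 := by rw [ha]; omega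
  have hR₁ := levelBudget_pin1 M H ha₁ hb hd (by omega) (by omega) hβ hβ1 hDN₁ hbβ₁ hdβ₁ hs₁' hs''₁ (by omega) (by omega) hxε₁
    hxD h2D hLN₁ h1₁' h2₁' h3₁ h4₁ h5₁
  -- domination
  have hlaw0 : 0 ≤ shellLaw M.2.partner univ H (2 * s + 1) 1 x := shellLaw_nonneg (π := M.2.partner) _ _ _ _ _
  have hG1_0 : 0 ≤ ∑ v ∈ reps M.2.partner (vAA M.2.partner univ H),
      shellLaw M.2.partner (univ \ {v, M.2.partner v}) H (2 * s₁ + 1) 1 x₁ :=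
    sum_nonneg fun _ _ => shellLaw_nonneg (π := M.2.partner) _ _ _ _ _
  have hΓ₀0 : 0 ≤ (1 + 4 * (Real.sqrt N₀ + 1) / 3 *
          (2 * Real.sqrt 192 * Real.sqrt (2 * (2 * (D : ℝ) + 1) * (1 + 8 * (L + D + 1) / ((β ^ 2 / 8) ^ 4 * (β * ((N₀ : ℝ) - 2 * D)))) /
            ((β ^ 2 / 8) ^ 4 * (β * ((N₀ : ℝ) - 2 * D)))))) :=
    le_trans zero_le_one (le_add_of_nonneg_right (by positivity))
  have hΓ₁0 : 0 ≤ (1 + 4 * (Real.sqrt N₁ + 1) / 3 *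
          (2 * Real.sqrt 192 * Real.sqrt (2 * (2 * (D : ℝ) + 1) * (1 + 8 * (L + D + 1) / ((β ^ 2 / 8) ^ 4 * (β * ((N₁ : ℝ) - 2 * D)))) /
            ((β ^ 2 / 8) ^ 4 * (β * ((N₁ : ℝ) - 2 * D)))))) :=
    le_trans zero_le_one (le_add_of_nonneg_right (by positivity))
  have hq₀0 : 0 ≤ (4 * ((1 + 8 * (L + D + 1) / ((β ^ 2 / 8) ^ 4 * (β * ((N₀ : ℝ) - 2 * D)))) *
          (8 * (L + D + 1) / ((β ^ 2 / 8) ^ 4 * (β * ((N₀ : ℝ) - 2 * D))) +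
            2 * Real.sqrt 192 * Real.sqrt (2 * (2 * (D : ℝ) + 1) * (1 + 8 * (L + D + 1) / ((β ^ 2 / 8) ^ 4 * (β * ((N₀ : ℝ) - 2 * D)))) /
            ((β ^ 2 / 8) ^ 4 * (β * ((N₀ : ℝ) - 2 * D)))))) ^ 2 / (3 * β)) := div_nonneg (mul_nonneg (by norm_num) (sq_nonneg _)) (by positivity)
  have hq₁0 : 0 ≤ (4 * ((1 + 8 * (L + D + 1) / ((β ^ 2 / 8) ^ 4 * (β * ((N₁ : ℝ) - 2 * D)))) *
          (8 * (L + D + 1) / ((β ^ 2 / 8) ^ 4 * (β * ((N₁ : ℝ) - 2 * D))) +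
            2 * Real.sqrt 192 * Real.sqrt (2 * (2 * (D : ℝ) + 1) * (1 + 8 * (L + D + 1) / ((β ^ 2 / 8) ^ 4 * (β * ((N₁ : ℝ) - 2 * D)))) /
            ((β ^ 2 / 8) ^ 4 * (β * ((N₁ : ℝ) - 2 * D)))))) ^ 2 / (3 * β)) := div_nonneg (mul_nonneg (by norm_num) (sq_nonneg _)) (by positivity)
  have hτ₁ := exp_far_mono (L := L) (D := (D : ℝ)) hN1pos hN1N0
  have hτ0 : ∀ N : ℝ, 0 ≤ Real.exp (-((L - 2 * D) ^ 2 / (4 * N))) := fun _ => Real.exp_nonneg _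
  refine ⟨fun k hk => ?_, fun k hk => ?_⟩
  · have h := hR₀ k hk
    have h' := lqShape_dominate (κ' := 1) (κ := 1) (w := (4 / 3 : ℝ) ^ k) (by simpa only [one_mul] using h) hΓ₀0 hΓ₀ hq₀0 hq₀ hlaw0
      zero_le_one le_rfl (by positivity) (hτ0 _) le_rfl
    simpa only [one_mul] using h'
  · exact lqShape_dominate (hR₁ k hk) hΓ₁0 hΓ₁ hq₁0 hq₁ hG1_0 (Nat.cast_nonneg _) le_rfl (by positivity) (hτ0 _) hτ₁

/-! ### §2 Brick 130 discharged -/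

set_option maxHeartbeats 400000 in -- passes at the default 200 000; ×2 head-room (the three slots and brick 130 in one context)
/-- **BRICK 130's γ-DIRECTION CRITERION WITH (i), (ii), (iii) DISCHARGED (brick 141).** See the module docstring; `ε_A`, `ε_B(m)`, `ε_C` are printed
in the three smallness hypotheses. [cite: Rothvoss2017, §2 (PDF p. 6)] [cite: Agarwal2000DifferenceEquations, Thm. 1.8.5 (1.8.6), Remark 1.8.1 (1.8.8)]
[cite: RollinRoss2010, §4.1 Thm 4.2] -/
theorem gammaProfile_newton_eval_zero_ge_discharged (M : PMatch n) (H : Finset (Fin n)) {a a₂ b d N₀ N₁ N₂ s s₁ s₂ r D : ℕ}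
    (hN01 : N₁ + 1 = N₀) (hN12 : N₂ + 1 = N₁) (hs₁ : s₁ + 1 = s) (hs₂ : s₂ + 1 = s₁) (hr : r + 3 = s) (haa : a₂ + 2 = a)
    (ha : (reps M.2.partner (vAA M.2.partner univ H)).card = a)
    (hb : (reps M.2.partner (vBH M.2.partner univ H ∪ vBN M.2.partner univ H)).card = b)
    (hd : (reps M.2.partner (vDD M.2.partner univ H)).card = d) (hN : a + b + d = N₀) (hn : n = 2 * N₀)
    {β : ℝ} (hβ : 0 < β) (hβ1 : β ≤ 1 / 4) (hD1 : 1 ≤ D) (hDN : 16 * D + 16 ≤ N₂)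
    (hbβ : β * N₀ + 2 * D + 1 ≤ b) (hdβ : β * N₀ + 2 * D + 1 ≤ d)
    (hs : β * N₂ + D ≤ s₂) (hs' : 8 * (s : ℝ) ≤ (4 + β) * ((N₀ : ℝ) - 2 * D)) (hDs : D ≤ s₂) (hsn : 2 * s + 2 * D + 2 ≤ n)
    {ε L : ℝ} (h2D : 2 * (D : ℝ) ≤ L) (hLN : 2 * L ≤ N₂)
    (h1 : L + D + (ε + 8 + 14 * D + 1) ≤ β ^ 2 * N₂)
    (h2 : L + D + (ε + 8 + 14 * D + 1) + 3 ≤ β * ((N₂ : ℝ) - 2 * D) / 8)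
    (h3 : 2 * (L + D + 1) ≤ (β ^ 2 / 8) ^ 2 * (β * ((N₂ : ℝ) - 2 * D)))
    (h4 : 4 ≤ β * ((N₂ : ℝ) - 2 * D))
    (h5 : (D : ℝ) * (1 + 8 * (L + D + 1) / ((β ^ 2 / 8) ^ 4 * (β * ((N₂ : ℝ) - 2 * D)))) ≤
      (β ^ 2 / 8) ^ 4 * (β * ((N₂ : ℝ) - 2 * D)))
    {Lx : ℝ} (h2Lx : 2 ≤ Lx) (hLxN : Lx - 2 ≤ 2 * ((N₀ : ℝ) - 2))
    (hLx1 : Lx + 1 + (ε + 15) ≤ β * ((r : ℝ) + 2)) (hLx2 : Lx + 1 + (ε + 15) + 3 ≤ β * ((N₀ : ℝ) - 2) / 8)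
    (hwin : 2 * (Lx + 1 + 1) ≤ (β ^ 2 / 8) ^ 2 * (β * ((N₀ : ℝ) - 2))) (hN4 : 4 ≤ β * ((N₀ : ℝ) - 2))
    (hkV : (1 : ℝ) * (1 + 8 * (Lx + 1 + 1) / ((β ^ 2 / 8) ^ 4 * (β * ((N₀ : ℝ) - 2)))) ≤
      (β ^ 2 / 8) ^ 4 * (β * ((N₀ : ℝ) - 2)))
    {E Far : ℝ} (hE0 : 0 ≤ E) (hFar0 : 0 ≤ Far)
    (hE : (((1 + 8 * (Lx + 1 + 1) / ((β ^ 2 / 8) ^ 4 * (β * ((N₀ : ℝ) - 2)))) *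
            (8 * (Lx + 1 + 1) / ((β ^ 2 / 8) ^ 4 * (β * ((N₀ : ℝ) - 2))) +
              2 * Real.sqrt 192 * Real.sqrt (2 * (2 * (1 : ℝ) + 1) *
                (1 + 8 * (Lx + 1 + 1) / ((β ^ 2 / 8) ^ 4 * (β * ((N₀ : ℝ) - 2)))) /
                  ((β ^ 2 / 8) ^ 4 * (β * ((N₀ : ℝ) - 2)))))) ^ (2 * 1) *
          (1 + 4 * (Real.sqrt ((N₀ : ℝ) - 2) + 1) / 3 *
            (2 * Real.sqrt 192 * Real.sqrt (2 * (2 * (1 : ℝ) + 1) *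
              (1 + 8 * (Lx + 1 + 1) / ((β ^ 2 / 8) ^ 4 * (β * ((N₀ : ℝ) - 2)))) /
                ((β ^ 2 / 8) ^ 4 * (β * ((N₀ : ℝ) - 2))))))) ≤ E)
    (hFar : (4 : ℝ) ^ 1 * Real.exp (-((Lx - 2 * 1) ^ 2 / (4 * ((N₀ : ℝ) - 2)))) ≤ Far)
    {Γ q : ℝ}
    (hΓ₀ : (1 + 4 * (Real.sqrt N₀ + 1) / 3 *
          (2 * Real.sqrt 192 * Real.sqrt (2 * (2 * (D : ℝ) + 1) * (1 + 8 * (L + D + 1) / ((β ^ 2 / 8) ^ 4 * (β * ((N₀ : ℝ) - 2 * D)))) /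
            ((β ^ 2 / 8) ^ 4 * (β * ((N₀ : ℝ) - 2 * D)))))) ≤ Γ)
    (hΓ₁ : (1 + 4 * (Real.sqrt N₁ + 1) / 3 *
          (2 * Real.sqrt 192 * Real.sqrt (2 * (2 * (D : ℝ) + 1) * (1 + 8 * (L + D + 1) / ((β ^ 2 / 8) ^ 4 * (β * ((N₁ : ℝ) - 2 * D)))) /
            ((β ^ 2 / 8) ^ 4 * (β * ((N₁ : ℝ) - 2 * D)))))) ≤ Γ)
    (hΓ₂ : (1 + 4 * (Real.sqrt N₂ + 1) / 3 *
          (2 * Real.sqrt 192 * Real.sqrt (2 * (2 * (D : ℝ) + 1) * (1 + 8 * (L + D + 1) / ((β ^ 2 / 8) ^ 4 * (β * ((N₂ : ℝ) - 2 * D)))) /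
            ((β ^ 2 / 8) ^ 4 * (β * ((N₂ : ℝ) - 2 * D)))))) ≤ Γ)
    (hq₀ : (4 * ((1 + 8 * (L + D + 1) / ((β ^ 2 / 8) ^ 4 * (β * ((N₀ : ℝ) - 2 * D)))) *
          (8 * (L + D + 1) / ((β ^ 2 / 8) ^ 4 * (β * ((N₀ : ℝ) - 2 * D))) +
            2 * Real.sqrt 192 * Real.sqrt (2 * (2 * (D : ℝ) + 1) * (1 + 8 * (L + D + 1) / ((β ^ 2 / 8) ^ 4 * (β * ((N₀ : ℝ) - 2 * D)))) /
            ((β ^ 2 / 8) ^ 4 * (β * ((N₀ : ℝ) - 2 * D)))))) ^ 2 / (3 * β)) ≤ q)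
    (hq₁ : (4 * ((1 + 8 * (L + D + 1) / ((β ^ 2 / 8) ^ 4 * (β * ((N₁ : ℝ) - 2 * D)))) *
          (8 * (L + D + 1) / ((β ^ 2 / 8) ^ 4 * (β * ((N₁ : ℝ) - 2 * D))) +
            2 * Real.sqrt 192 * Real.sqrt (2 * (2 * (D : ℝ) + 1) * (1 + 8 * (L + D + 1) / ((β ^ 2 / 8) ^ 4 * (β * ((N₁ : ℝ) - 2 * D)))) /
            ((β ^ 2 / 8) ^ 4 * (β * ((N₁ : ℝ) - 2 * D)))))) ^ 2 / (3 * β)) ≤ q)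
    (hq₂ : (4 * ((1 + 8 * (L + D + 1) / ((β ^ 2 / 8) ^ 4 * (β * ((N₂ : ℝ) - 2 * D)))) *
          (8 * (L + D + 1) / ((β ^ 2 / 8) ^ 4 * (β * ((N₂ : ℝ) - 2 * D))) +
            2 * Real.sqrt 192 * Real.sqrt (2 * (2 * (D : ℝ) + 1) * (1 + 8 * (L + D + 1) / ((β ^ 2 / 8) ^ 4 * (β * ((N₂ : ℝ) - 2 * D)))) /
            ((β ^ 2 / 8) ^ 4 * (β * ((N₂ : ℝ) - 2 * D)))))) ^ 2 / (3 * β)) ≤ q)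
    (hqh : q ≤ 1 / 2)
    (ψ : ℤ → ℝ) {G : ℝ} (hψ0 : ∀ y ∈ Icc (0 : ℤ) ((2 * s + 1 : ℕ) : ℤ), 0 ≤ ψ y) (hψG : ∀ y ∈ Icc (0 : ℤ) ((2 * s + 1 : ℕ) : ℤ), ψ y ≤ G)
    {gam lam kap : ℝ} (hgam : |gam| ≤ 1) (hlam : |lam| ≤ 1) (hkap : |kap| ≤ 1)
    (B : Finset ℤ) (hB : ∀ y ∈ B, (2 * (D : ℤ) + 4 ≤ y ∧ y ≤ ((2 * s + 1 : ℕ) : ℤ)) ∧ |(y : ℝ) - (2 * (s : ℝ) + 1) * H.card / n| < ε)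
    {cV LB : ℝ} (hcV : 0 < cV) (hLB : 0 < LB)
    (hV : ∀ y ∈ B, ∀ m : ℝ, cV * shellLaw M.2.partner univ H (2 * s + 1) 1 y ≤
      (∑ U ∈ ((shell M.2.partner (2 * s + 1) 1).filter fun U => ((U ∩ H).card : ℤ) = y), (((((reps M.2.partner (vAA M.2.partner univ H)).filter fun v => v ∈ U ∧ M.2.partner v ∈ U).card : ℕ) : ℝ) - m) ^ 2) /
        ((shell M.2.partner (2 * s + 1) 1).card : ℝ))
    (hLBl : ∀ y ∈ B, LB ≤ shellLaw M.2.partner univ H (2 * s + 1) 1 y)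
    (hεA : ((E * ((n : ℝ) * ((n : ℝ) - 2) / ((2 * (r : ℝ) + 6) * ((n : ℝ) - 2 * r - 8))) / 4 + 1 / ((r : ℝ) + 1)) +
          ((E * ((n : ℝ) * ((n : ℝ) - 2) / ((2 * (r : ℝ) + 6) * ((n : ℝ) - 2 * r - 8))) / 4 * (2 * (a : ℝ) ^ 2 / ((r : ℝ) + 1) + (2 * (a : ℝ) + 1) * a / ((r : ℝ) + 2)) +
            (2 * (a : ℝ) + 1) * ((r : ℝ) + 3) / (2 * ((r : ℝ) + 2) * ((r : ℝ) + 1)) *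
              ((a : ℝ) * (4 * Γ * q + (2 + 4 * Γ * q) / (2 * (r : ℝ) + 6))) +
            (a : ℝ) * (2 * (a : ℝ) + r + 3) / (2 * ((r : ℝ) + 2) * ((r : ℝ) + 1)) * (1 + 2 * Γ * q)) +
            (D : ℝ) * (2 * Γ * q ^ 2 * (a : ℝ) ^ 2 + 8 * (D : ℝ) * Γ * q * (a : ℝ) ^ 2 / (2 * (r : ℝ) + 6) +
            32 * (D : ℝ) ^ 2 * Γ * (a : ℝ) ^ 2 / ((2 * (r : ℝ) + 6) * (2 * (r : ℝ) + 4)) +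
            (2 * (a : ℝ) + 1) * a * (Γ * q ^ 2 + 4 * (D : ℝ) * Γ * q / (2 * (r : ℝ) + 6)))) / cV +
          ((((2 * (a : ℝ) + 1) * ((r : ℝ) + 3) / (2 * ((r : ℝ) + 2) * ((r : ℝ) + 1)) * (16 * (a : ℝ) / 3) +
            (a : ℝ) * (2 * (a : ℝ) + r + 3) / (2 * ((r : ℝ) + 2) * ((r : ℝ) + 1)) * (8 / 3)) +
              (D : ℝ) * (4 / 3 : ℝ) ^ D *
            ((a : ℝ) ^ 2 * ((2 * (r : ℝ) + 6) * (2 * (r : ℝ) + 4) / ((n : ℝ) * ((n : ℝ) - 2)) + 8 * (D : ℝ) * (2 * (r : ℝ) + 4) / ((n : ℝ) * ((n : ℝ) - 2)) +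
                32 * (D : ℝ) ^ 2 / ((n : ℝ) * ((n : ℝ) - 2)) + 1) +
              (2 * (a : ℝ) + 1) * a * ((2 * (r : ℝ) + 6 + 4 * D) / (n : ℝ)))) * Real.exp (-((L - 2 * D) ^ 2 / (4 * N₀))) +
            ((((r : ℝ) + 2 + a) ^ 2 + 2 * ((r : ℝ) + 2) ^ 2 / ((r : ℝ) + 1) + (2 * (a : ℝ) + 1)) / 4) * Far) / (LB * cV)) ≤ 3 / 4)
    (hεB : ∀ m : ℝ, 0 ≤ m → m ≤ a →
      (m * (Γ * (2 * q + 3 * D / s) + 2 * Γ * q) +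
          (D : ℝ) * (4 / 3 : ℝ) ^ D * ((2 * (s : ℝ) / n + 4 * D / n) * ((a : ℝ) * Real.exp (-((L - 2 * D) ^ 2 / (4 * N₀)))) + m * Real.exp (-((L - 2 * D) ^ 2 / (4 * N₀)))) / LB) /
        Real.sqrt cV ≤ 1 / 4)
    (hεC : (2 * Γ * q + (D : ℝ) * (4 / 3 : ℝ) ^ D * Real.exp (-((L - 2 * D) ^ 2 / (4 * N₀))) / LB) ≤ 1 / 4) :
    -((2 : ℝ) ^ (D + 1) * G * (2 * (n : ℝ) + 3 * (((2 * s + 1 : ℕ) : ℕ) : ℝ)) ^ 2 *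
        ∑ y ∈ Icc (0 : ℤ) ((2 * s + 1 : ℕ) : ℤ) \ B, ∑ j ∈ range (D + 1), shellLaw M.2.partner univ H (2 * s + 1) (2 * j + 1) y) ≤
      (DesignRemainder.newtonPolyOdd D (fun c => ((∑ U' ∈ shell M.2.partner (2 * s + 1) c,
          ψ ((U' ∩ H).card : ℤ) *
            (2 * gam * ((((reps M.2.partner (vAA M.2.partner univ H)).filter fun v => v ∈ U' ∧ M.2.partner v ∈ U').card : ℕ) : ℝ) +
              2 * lam * ((U' ∩ H).card : ℤ) + kap * ((2 * s + 1 : ℕ) : ℝ)) ^ 2) /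
          ((shell M.2.partner (2 * s + 1) c).card : ℝ)))).eval 0 := by
  classical
  have ha2 : 2 ≤ a := by omega
  have ha0 : (0 : ℝ) ≤ a := Nat.cast_nonneg _
  have hΓ₀0 : 0 ≤ (1 + 4 * (Real.sqrt N₀ + 1) / 3 *
          (2 * Real.sqrt 192 * Real.sqrt (2 * (2 * (D : ℝ) + 1) * (1 + 8 * (L + D + 1) / ((β ^ 2 / 8) ^ 4 * (β * ((N₀ : ℝ) - 2 * D)))) /
            ((β ^ 2 / 8) ^ 4 * (β * ((N₀ : ℝ) - 2 * D)))))) :=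
    le_trans zero_le_one (le_add_of_nonneg_right (by positivity))
  have hΓ1 : 1 ≤ Γ := le_trans (le_add_of_nonneg_right (by positivity)) hΓ₀
  have hq0 : 0 ≤ q := le_trans (div_nonneg (mul_nonneg (by norm_num) (sq_nonneg _)) (by positivity)) hq₀
  have hτ0 : 0 ≤ Real.exp (-((L - 2 * D) ^ 2 / (4 * N₀))) := Real.exp_nonneg _
  have hB' : B ⊆ Icc (0 : ℤ) ((2 * s + 1 : ℕ) : ℤ) := by
    intro y hy
    obtain ⟨⟨h1y, h2y⟩, _⟩ := hB y hy
    rw [mem_Icc]; constructor <;> omega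
  -- the centring
  refine gammaProfile_newton_eval_zero_ge_of_centred D (2 * s + 1) M H ψ hψ0 hψG hgam hlam hkap B hB'
    (fun y => ((∑ U' ∈ ((shell M.2.partner (2 * s + 1) 1).filter fun U => ((U ∩ H).card : ℤ) = y),
              ((((reps M.2.partner (vAA M.2.partner univ H)).filter fun v => v ∈ U' ∧ M.2.partner v ∈ U').card : ℕ) : ℝ)) /
            ((((shell M.2.partner (2 * s + 1) 1).filter fun U => ((U ∩ H).card : ℤ) = y).card : ℕ) : ℝ)))
    (εA := 3 / 4) (εB := 1 / 4) (εC := 1 / 4) (by norm_num) (by norm_num) (by norm_num)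
    (fun y _ => hcentre_condMean M H (2 * s + 1) y) (fun y hy => ?_) (fun y hy => ?_) (fun y hy => ?_)
  all_goals obtain ⟨⟨h1y, h2y⟩, hwy⟩ := hB y hy
  all_goals obtain ⟨x, rfl⟩ : ∃ x : ℕ, (x : ℤ) = y := ⟨y.toNat, Int.toNat_of_nonneg (by omega)⟩
  all_goals have hwx : |(x : ℝ) - (2 * (s : ℝ) + 1) * H.card / n| < ε := by simpa only [Int.cast_natCast] using hwy
  · -- (hA): brick 141a at `x`, then `ε_A ≤ 3/4`
    have hm := condMean_mem_Icc M H (2 * s + 1) (x : ℤ)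
    rw [ha] at hm
    have hslot := centredSecond_slot M H hN01 hN12 hs₁ hs₂ hr (x := x) (x₁ := x - 2) (x₂ := x - 4) (by omega) (by omega) haa ha hb hd hN hn
      hβ hβ1 hD1 hDN hbβ hdβ hs hs' hDs hsn hwx (by omega) h2D hLN h1 h2 h3 h4 h5 h2Lx hLxN hLx1 hLx2 hwin hN4 hkV hE0 hFar0 hE hFar
      hΓ₀ hΓ₁ hΓ₂ hq₀ hq₁ hq₂ (by linarith only [hqh]) _ (hcentre_condMean M H (2 * s + 1) (x : ℤ)) hcV hLB (hV _ hy _) (hLBl _ hy)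
    refine hslot.trans (mul_le_mul_of_nonneg_right hεA ?_)
    exact div_nonneg (sum_nonneg fun _ _ => sq_nonneg _) (Nat.cast_nonneg _)
  · -- (hBm): eng's budget form with the dominated budgets, then `ε_B(m) ≤ 1/4`
    have hm := condMean_mem_Icc M H (2 * s + 1) (x : ℤ)
    rw [ha] at hm
    obtain ⟨hB₀, hB₁⟩ := budgets_zero_one_at M H hN01 hN12 hs₁ hs₂ (x := x) (x₁ := x - 2) (by omega) ha2 ha hb hd hN hn hβ hβ1 hD1 hDN
      hbβ hdβ hs hs' hDs hsn hwx (by omega) h2D hLN h1 h2 h3 h4 h5 hΓ₀ hΓ₁ hq₀ hq₁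
    have hturn := sum_abs_fwdDiff_centredFirst_le_of_budgets M H hs₁ (x := x) (x₁ := x - 2) (by omega) (by omega) hsn _ hΓ1 hq0 hqh hτ0
      hΓ1 hq0 hqh hτ0 hB₀ hB₁ (hcentre_condMean M H (2 * s + 1) (x : ℤ)) hLB (hLBl _ hy) hcV (hV _ hy _)
    rw [ha] at hturn
    refine hturn.trans (mul_le_mul_of_nonneg_right (hεB _ hm.1 hm.2) (Real.sqrt_nonneg _))
  · -- (hC): eng's closed form with the dominated budget, then `ε_C ≤ 1/4`
    obtain ⟨hB₀, -⟩ := budgets_zero_one_at M H hN01 hN12 hs₁ hs₂ (x := x) (x₁ := x - 2) (by omega) ha2 ha hb hd hN hn hβ hβ1 hD1 hDN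
      hbβ hdβ hs hs' hDs hsn hwx (by omega) h2D hLN h1 h2 h3 h4 h5 hΓ₀ hΓ₁ hq₀ hq₁
    have hC := sum_abs_fwdDiff_shellLaw_le_of_budget (univ : Finset (Fin n)) H (le_trans zero_le_one hΓ1) hq0 hqh hτ0 hB₀ hLB (hLBl _ hy)
    exact hC.trans (mul_le_mul_of_nonneg_right hεC (shellLaw_nonneg (π := M.2.partner) _ _ _ _ _))

end Summit.PneNP.PneNP.Theorems.ChebyshevTracialDesignGammaDirectionCentredDischarge

end
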